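import Literature.NumberTheory.Transcendental.PadicWordValues
import Literature.NumberTheory.Transcendental.LinGroupKWordSizes
import Literature.NumberTheory.Transcendental.PadicBoxPrinciple
import Mathlib.NumberTheory.Padics.Complex
import HarnessLib

/-!
# The `p`-adic auxiliary function on `𝔾ₐ^{d₀} × 𝔾ₘ^{d₁}` (Waldschmidt 1988, Prop. 6.1, `p`-adic case): the core construction

Topic `Literature/NumberTheory/Transcendental` (namespace `Literature.NumberTheory.Transcendental`,
grouping sub-namespace `LinGroupK`). Everything here is PROVED; one definition with a body
(`LinGroupK.boxPoly`, the auxiliary polynomial attached to an integer vector); no named facts.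

This file runs, over `K = ℚ̄_p ⊂ ℂ_p`, the interpolation-free construction of the auxiliary
function of the several-variable Gel'fond–Schneider method ([Waldschmidt1988, §6 Prop. 6.1];
Waldschmidt, Invent. Math. 63 (1981), §3, "Théorème 3.1.p"; [Roy1992, §1]: "`K = ℂ` or `ℂ_p`")
with PRESCRIBED numerical parameters, leaving their asymptotic choice to the sequel. Data in
normal form (a frame `Φ` of size `p⁻²` with coefficients in a `ℚ_p`-finite subfield `M ⊂ K`;
vectors `ỹᵢ`, `w̃_l ∈ K^n` of norm `≤ 1`; units `αᵢⱼ` with `αᵢⱼ = exp(yᵢⱼ)` in `ℂ_p`,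
`yᵢ = φ(ỹᵢ)`; a number field `k₀ →+* K` containing the `yᵢ⁰`, `αᵢⱼ`, `w_l = φ(w̃_l)`, with common
denominator `d` and house bound) and parameters `S, D₀, D₁, T, L, Q` satisfying

* (P1) the box-principle count `p^{f(L+2a)(L+T)^n} < (Q+1)^U`, `U = (D₀/d₀+1)^{d₀}(D₁/d₁+1)^{d₁}`
  (`a` the constant of `PadicBox.exists_small_int_combination` for `M`, `f = [M:ℚ_p]`),
* (P2) the Liouville count `B(ℓ)^{[k₀:ℚ]} < p^L` for `ℓ < T` (`B(ℓ)` the explicit house bound of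
  `LinGroupK.isGood_evalAt_gammaOf ∘ isGood_coeff_wordDeriv`),

`LinGroupK.exists_auxiliary_of_params` produces `P ≠ 0` with `deg_X P ≤ D₀`, `deg_Y P ≤ D₁`
vanishing to order `≥ T` along `W = span(w_l)` at all points `γ(h)`, `0 ≤ hᵢ ≤ S`:
the integer vector `q` given by the box principle applied to the Taylor coefficients
`tc_κ(X^{s})`, `|κ| < L + T`, makes `‖tc_κ(P)‖ ≤ p^{-L}`; words of length `< T` and the natural
decay keep all relevant Taylor coefficients of `D_u P` below `p^{-L}`, so `‖(D_u P)(γ(h))‖ ≤ p^{-L}`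
(`Frame.norm_expPolyVal_le`, `Frame.coe_evalAt_gammaOf_eq_expPolyVal`); the same number computed
in `k₀` is good with house `B(ℓ)`, and (P2) with the `p`-adic Liouville inequality forces it to
vanish.

## References

* [Waldschmidt1988] M. Waldschmidt, *On the transcendence methods of Gel'fond and Schneider in
  several variables*, New Advances in Transcendence Theory (A. Baker ed.), CUP 1988, 375–398, §6
  Proposition 6.1 (p. 389).
* [Roy1992] D. Roy, *Matrices whose coefficients are linear forms in logarithms*, J. Number Theory
  41 (1992) 22–47, §1 Theorem 1 (p. 25).
-/

noncomputable section

open MvPolynomial Finset Module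

namespace Literature.NumberTheory.Transcendental

namespace LinGroupK

/-! ### The box of exponents and the polynomial attached to an integer vector -/

section Box

variable {F : Type*} [Field F] {d₀ d₁ : ℕ}

/-- The exponent vector with prescribed `X`- and `Y`-entries. [folklore] -/
def boxExp (f : (Fin d₀ → ℕ) × (Fin d₁ → ℕ)) : Fin d₀ ⊕ Fin d₁ →₀ ℕ :=
  Finsupp.equivFunOnFinite.symm (Sum.elim f.1 f.2)

/-- Entries of `boxExp`. [folklore] -/
@[simp] theorem boxExp_inl (f : (Fin d₀ → ℕ) × (Fin d₁ → ℕ)) (i : Fin d₀) : boxExp f (Sum.inl i) = f.1 i := rfl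

/-- Entries of `boxExp`. [folklore] -/
@[simp] theorem boxExp_inr (f : (Fin d₀ → ℕ) × (Fin d₁ → ℕ)) (j : Fin d₁) : boxExp f (Sum.inr j) = f.2 j := rfl

/-- `boxExp` is injective. [folklore] -/
theorem boxExp_injective : Function.Injective (boxExp (d₀ := d₀) (d₁ := d₁)) := by
  intro f g h
  refine Prod.ext (funext fun i => ?_) (funext fun j => ?_)
  · simpa using congrArg (fun s => s (Sum.inl i)) h
  · simpa using congrArg (fun s => s (Sum.inr j)) h

/-- The exponents in the box `[0, E₀]^{d₀} × [0, E₁]^{d₁}`, indexed by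
`(Fin d₀ → Fin (E₀+1)) × (Fin d₁ → Fin (E₁+1))`. [folklore] -/
def boxIdx (E₀ E₁ : ℕ) (u : (Fin d₀ → Fin (E₀ + 1)) × (Fin d₁ → Fin (E₁ + 1))) : Fin d₀ ⊕ Fin d₁ →₀ ℕ :=
  boxExp (fun i => (u.1 i : ℕ), fun j => (u.2 j : ℕ))

/-- `boxIdx` is injective. [folklore] -/
theorem boxIdx_injective (E₀ E₁ : ℕ) : Function.Injective (boxIdx (d₀ := d₀) (d₁ := d₁) E₀ E₁) := by
  intro u v h
  have h' := boxExp_injective h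
  simp only [Prod.mk.injEq] at h'
  refine Prod.ext (funext fun i => Fin.ext ?_) (funext fun j => Fin.ext ?_)
  · exact congrFun h'.1 i
  · exact congrFun h'.2 j

variable (F) in
/-- **The polynomial attached to an integer vector on the box**: `P_q = ∑_u q_u X^{boxIdx u}`.
[cite: Waldschmidt1988, §6 (p. 389)] -/
def boxPoly (E₀ E₁ : ℕ) (q : (Fin d₀ → Fin (E₀ + 1)) × (Fin d₁ → Fin (E₁ + 1)) → ℤ) :
    MvPolynomial (Fin d₀ ⊕ Fin d₁) F :=
  ∑ u, monomial (boxIdx E₀ E₁ u) (q u : F)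

/-- Coefficients of `P_q` on the box. [folklore] -/
theorem coeff_boxPoly_boxIdx (E₀ E₁ : ℕ) (q : (Fin d₀ → Fin (E₀ + 1)) × (Fin d₁ → Fin (E₁ + 1)) → ℤ)
    (u : (Fin d₀ → Fin (E₀ + 1)) × (Fin d₁ → Fin (E₁ + 1))) :
    coeff (boxIdx E₀ E₁ u) (boxPoly F E₀ E₁ q) = (q u : F) := by
  classical
  rw [boxPoly, coeff_sum, Finset.sum_eq_single u]
  · rw [coeff_monomial, if_pos rfl]
  · intro v _ hv
    rw [coeff_monomial, if_neg]
    exact fun h => hv (boxIdx_injective E₀ E₁ h)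
  · intro h; exact absurd (Finset.mem_univ u) h

/-- Coefficients of `P_q` off the box vanish. [folklore] -/
theorem coeff_boxPoly_eq_zero (E₀ E₁ : ℕ) (q : (Fin d₀ → Fin (E₀ + 1)) × (Fin d₁ → Fin (E₁ + 1)) → ℤ)
    {s : Fin d₀ ⊕ Fin d₁ →₀ ℕ} (hs : s ∉ Set.range (boxIdx (d₀ := d₀) (d₁ := d₁) E₀ E₁)) :
    coeff s (boxPoly F E₀ E₁ q) = 0 := by
  classical
  rw [boxPoly, coeff_sum]
  refine Finset.sum_eq_zero fun u _ => ?_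
  rw [coeff_monomial, if_neg]
  exact fun h => hs ⟨u, h⟩

/-- Every coefficient of `P_q` is `0` or some `q_u`. [folklore] -/
theorem coeff_boxPoly_cases (E₀ E₁ : ℕ) (q : (Fin d₀ → Fin (E₀ + 1)) × (Fin d₁ → Fin (E₁ + 1)) → ℤ)
    (s : Fin d₀ ⊕ Fin d₁ →₀ ℕ) :
    coeff s (boxPoly F E₀ E₁ q) = 0 ∨ ∃ u, s = boxIdx E₀ E₁ u ∧ coeff s (boxPoly F E₀ E₁ q) = (q u : F) := by
  by_cases hs : s ∈ Set.range (boxIdx (d₀ := d₀) (d₁ := d₁) E₀ E₁)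
  · obtain ⟨u, rfl⟩ := hs
    exact Or.inr ⟨u, rfl, coeff_boxPoly_boxIdx E₀ E₁ q u⟩
  · exact Or.inl (coeff_boxPoly_eq_zero E₀ E₁ q hs)

/-- `deg_X P_q ≤ d₀ E₀`. [folklore] -/
theorem degX_boxPoly_le (E₀ E₁ : ℕ) (q : (Fin d₀ → Fin (E₀ + 1)) × (Fin d₁ → Fin (E₁ + 1)) → ℤ) :
    degX (boxPoly F E₀ E₁ q) ≤ d₀ * E₀ := by
  rw [degX_le_iff]
  intro s hs
  rw [MvPolynomial.mem_support_iff] at hs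
  rcases coeff_boxPoly_cases (F := F) E₀ E₁ q s with h0 | ⟨u, rfl, -⟩
  · exact absurd h0 hs
  · calc ∑ i, boxIdx E₀ E₁ u (Sum.inl i) ≤ ∑ _i : Fin d₀, E₀ :=
          Finset.sum_le_sum fun i _ => Nat.lt_succ_iff.1 (u.1 i).2
      _ = d₀ * E₀ := by simp

/-- `deg_Y P_q ≤ d₁ E₁`. [folklore] -/
theorem degY_boxPoly_le (E₀ E₁ : ℕ) (q : (Fin d₀ → Fin (E₀ + 1)) × (Fin d₁ → Fin (E₁ + 1)) → ℤ) :
    degY (boxPoly F E₀ E₁ q) ≤ d₁ * E₁ := by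
  rw [degY_le_iff]
  intro s hs
  rw [MvPolynomial.mem_support_iff] at hs
  rcases coeff_boxPoly_cases (F := F) E₀ E₁ q s with h0 | ⟨u, rfl, -⟩
  · exact absurd h0 hs
  · calc ∑ j, boxIdx E₀ E₁ u (Sum.inr j) ≤ ∑ _j : Fin d₁, E₁ :=
          Finset.sum_le_sum fun j _ => Nat.lt_succ_iff.1 (u.2 j).2
      _ = d₁ * E₁ := by simp

/-- `P_q ≠ 0` for `q ≠ 0` (characteristic `0`). [folklore] -/
theorem boxPoly_ne_zero [CharZero F] (E₀ E₁ : ℕ) {q : (Fin d₀ → Fin (E₀ + 1)) × (Fin d₁ → Fin (E₁ + 1)) → ℤ}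
    (hq : q ≠ 0) : boxPoly F E₀ E₁ q ≠ 0 := by
  obtain ⟨u, hu⟩ : ∃ u, q u ≠ 0 := by
    by_contra h
    push Not at h
    exact hq (funext h)
  intro h0
  have := coeff_boxPoly_boxIdx (F := F) E₀ E₁ q u
  rw [h0, coeff_zero] at this
  exact hu (by exact_mod_cast this.symm)

/-- Transport of `P_q` along a ring homomorphism. [folklore] -/
theorem map_boxPoly {F' : Type*} [Field F'] (φ : F →+* F') (E₀ E₁ : ℕ)
    (q : (Fin d₀ → Fin (E₀ + 1)) × (Fin d₁ → Fin (E₁ + 1)) → ℤ) :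
    map φ (boxPoly F E₀ E₁ q) = boxPoly F' E₀ E₁ q := by
  simp [boxPoly, map_monomial]

/-- The Taylor coefficients of `P_q` are the integer combinations of those of the monomials.
[folklore] -/
theorem taylorCoeff_boxPoly {n : ℕ} (Φ : Frame F n d₀ d₁) (κ : Fin n →₀ ℕ) (E₀ E₁ : ℕ)
    (q : (Fin d₀ → Fin (E₀ + 1)) × (Fin d₁ → Fin (E₁ + 1)) → ℤ) :
    Φ.taylorCoeff κ (boxPoly F E₀ E₁ q) = ∑ u, (q u : F) * Φ.taylorCoeff κ (monomial (boxIdx E₀ E₁ u) 1) := by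
  rw [boxPoly, map_sum]
  refine Finset.sum_congr rfl fun u _ => ?_
  rw [show monomial (boxIdx E₀ E₁ u) (q u : F) = (q u : F) • monomial (boxIdx E₀ E₁ u) (1 : F) by
    rw [smul_monomial, smul_eq_mul, mul_one], map_smul, smul_eq_mul]

/-- `gammaOf` only depends on the additive parts of the `yᵢ`. [folklore] -/
theorem gammaOf_congr_fst {m : ℕ} {y y' : Fin m → (Fin d₀ → F) × (Fin d₁ → F)}
    (h : ∀ i, (y i).1 = (y' i).1) (α : Fin m → Fin d₁ → Fˣ) : gammaOf y α = gammaOf y' α := by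
  ext k
  · apply Multiplicative.toAdd.injective
    simp [gammaOf, h]
  · rfl

end Box

/-! ### The core construction -/

section Core

variable (p : ℕ) [Fact p.Prime]

open AlgSize

set_option maxHeartbeats 1600000 in
/-- **The `p`-adic auxiliary function with prescribed parameters** (core of
[Waldschmidt1988, Prop. 6.1], `p`-adic case, interpolation-free). See the module docstring for the
data (normal form) and the two counting hypotheses (P1), (P2); conclusion: a non-zero
`P ∈ K[X, Y]`, `K = ℚ̄_p`, with `deg_X P ≤ D₀`, `deg_Y P ≤ D₁`, integer coefficients, vanishing to
order `≥ T` along `W = span_K(φ(w̃_l))` at every point `γ(h) = (∑ hᵢyᵢ⁰, ∏ αᵢⱼ^{hᵢ})`, `0 ≤ hᵢ ≤ S`.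
[cite: Waldschmidt1988, §6 Proposition 6.1 (p. 389)] [cite: Roy1992, §1 Theorem 1 (p. 25)] -/
theorem exists_auxiliary_of_params {d₀ d₁ n m t : ℕ}
    (Φ : Frame (PadicAlgCl p) n d₀ d₁) (M : IntermediateField ℚ_[p] (PadicAlgCl p))
    [FiniteDimensional ℚ_[p] M] (hΦM : (∀ i k, Φ.A i k ∈ M) ∧ ∀ j k, Φ.B j k ∈ M)
    (hΦ : Φ.Small (((p : ℝ)⁻¹) ^ 2))
    (yt : Fin m → Fin n → PadicAlgCl p) (hyt : ∀ i k, ‖yt i k‖ ≤ 1)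
    (α : Fin m → Fin d₁ → (PadicAlgCl p)ˣ)
    (hα : ∀ i j, ((α i j : PadicAlgCl p) : ℂ_[p]) = NormedSpace.exp (((Φ.vec (yt i)).2 j : ℂ_[p])))
    (wt : Fin t → Fin n → PadicAlgCl p) (hwt : ∀ l k, ‖wt l k‖ ≤ 1)
    {k₀ : Type} [Field k₀] [NumberField k₀] (e : k₀ →+* PadicAlgCl p)
    (y₀ : Fin m → Fin d₀ → k₀) (hy₀ : ∀ i i₀, e (y₀ i i₀) = (Φ.vec (yt i)).1 i₀)
    (α₀ : Fin m → Fin d₁ → k₀ˣ) (hα₀ : ∀ i j, e (α₀ i j : k₀) = (α i j : PadicAlgCl p))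
    (w₀ : Fin t → (Fin d₀ → k₀) × (Fin d₁ → k₀)) (hw₀ : ∀ l, tmapHom e (w₀ l) = Φ.vec (wt l))
    {d : ℤ} (hd : d ≠ 0) {Cg : ℝ} (hCg : 1 ≤ Cg)
    (hgy : ∀ i i₀, IsGood d 1 Cg (y₀ i i₀)) (hgα : ∀ i j, IsGood d 1 Cg (α₀ i j : k₀))
    (hgw : ∀ l, (∀ i, IsGood d 1 Cg ((w₀ l).1 i)) ∧ ∀ j, IsGood d 1 Cg ((w₀ l).2 j)) :
    ∃ a : ℕ, ∀ (S D₀ D₁ T L Q : ℕ),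
      p ^ (finrank ℚ_[p] M * (L + 2 * a) * (L + T) ^ n) <
        (Q + 1) ^ ((D₀ / d₀ + 1) ^ d₀ * (D₁ / d₁ + 1) ^ d₁) →
      (∀ ℓ : ℕ, ℓ < T →
        ((((max D₀ D₁ + 1) ^ (d₀ + d₁) : ℕ) : ℝ) * ((Q : ℝ) * (Cg * ((d₀ : ℝ) * (D₀ + 1) + D₁ + 1)) ^ ℓ *
          (((|(d : ℝ)|) * ((m : ℝ) * S * Cg + 1)) ^ D₀ * ((|(d : ℝ)|) ^ 2 * Cg) ^ (m * S * D₁)))) ^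
            finrank ℚ k₀ < (p : ℝ) ^ L) →
      ∃ P : MvPolynomial (Fin d₀ ⊕ Fin d₁) (PadicAlgCl p), P ≠ 0 ∧ degX P ≤ D₀ ∧ degY P ≤ D₁ ∧
        ∀ h : Fin m → ℕ, (∀ i, h i ≤ S) →
          VanishesAlg P (Submodule.span (PadicAlgCl p) (Set.range fun l => Φ.vec (wt l)))
            (gammaOf (fun i => Φ.vec (yt i)) α (Multiplicative.ofAdd fun i => (h i : ℤ))) T := by
  classical
  have hp : p.Prime := Fact.out
  have hp0 : (0 : ℝ) < p := by exact_mod_cast hp.pos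
  have hp1 : (1 : ℝ) < p := by exact_mod_cast hp.one_lt
  -- notation
  set ρ : ℝ := ((p : ℝ)⁻¹) ^ 2 with hρdef
  have hρ0 : 0 ≤ ρ := by positivity
  have hρp : ρ < (p : ℝ)⁻¹ := by
    rw [hρdef, sq]
    exact mul_lt_of_lt_one_left (inv_pos.2 hp0) (inv_lt_one_of_one_lt₀ hp1)
  have hpρ : (p : ℝ) * ρ = (p : ℝ)⁻¹ := by
    rw [hρdef, sq, ← mul_assoc, mul_inv_cancel₀ hp0.ne', one_mul]
  have hρ1 : ρ ≤ 1 := hρp.le.trans (inv_le_one_of_one_le₀ hp1.le)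
  -- the isometric embedding into `ℂ_p`
  set ι : PadicAlgCl p →+* ℂ_[p] := algebraMap (PadicAlgCl p) ℂ_[p] with hιdef
  have hι : ∀ x, ‖ι x‖ = ‖x‖ := fun x => PadicComplex.norm_extends p x
  -- the frame over `M` and the box constant
  set Mv : Submodule ℚ_[p] (PadicAlgCl p) := M.toSubalgebra.toSubmodule with hMv
  let ΦM : Frame M n d₀ d₁ := ⟨fun i k => ⟨Φ.A i k, hΦM.1 i k⟩, fun j k => ⟨Φ.B j k, hΦM.2 j k⟩⟩
  have hΦMmap : ΦM.mapHom (algebraMap M (PadicAlgCl p)) = Φ := by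
    rcases Φ with ⟨A, B⟩
    rfl
  obtain ⟨a, ha⟩ := PadicBox.exists_small_int_combination (p := p) (M := Mv)
  refine ⟨a, fun S D₀ D₁ T L Q hP1 hP2 => ?_⟩
  -- `Q ≥ 1`
  have hQ1 : 1 ≤ Q := by
    by_contra hQ
    have hQ0 : Q = 0 := by omega
    rw [hQ0, zero_add, one_pow] at hP1
    exact absurd hP1 (not_lt.2 (Nat.one_le_pow _ _ hp.pos))
  -- the boxes
  set E₀ := D₀ / d₀ with hE₀
  set E₁ := D₁ / d₁ with hE₁
  have hE₀D : d₀ * E₀ ≤ D₀ := Nat.mul_div_le D₀ d₀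
  have hE₁D : d₁ * E₁ ≤ D₁ := Nat.mul_div_le D₁ d₁
  let BoxU := (Fin d₀ → Fin (E₀ + 1)) × (Fin d₁ → Fin (E₁ + 1))
  let BoxN := Fin n → Fin (L + T)
  let κof : BoxN → (Fin n →₀ ℕ) := fun f => Finsupp.equivFunOnFinite.symm fun v => (f v : ℕ)
  have hκof : ∀ f v, κof f v = f v := fun f v => rfl
  -- the vectors for the box principle: Taylor coefficients of the monomials, in `M`
  let ev : BoxN → BoxU → Mv := fun f u =>
    ⟨(ΦM.taylorCoeff (κof f) (monomial (boxIdx E₀ E₁ u) (1 : M)) : M), (ΦM.taylorCoeff _ _).2⟩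
  have hev : ∀ f u, ((ev f u : Mv) : PadicAlgCl p) = Φ.taylorCoeff (κof f) (monomial (boxIdx E₀ E₁ u) 1) := by
    intro f u
    have h1 : ((ev f u : Mv) : PadicAlgCl p) =
        (algebraMap M (PadicAlgCl p)) (ΦM.taylorCoeff (κof f) (monomial (boxIdx E₀ E₁ u) (1 : M))) := rfl
    rw [h1, Frame.map_taylorCoeff, hΦMmap, map_monomial, map_one]
  have hev1 : ∀ f u, ‖ev f u‖ ≤ 1 := by
    intro f u
    have hn : ‖ev f u‖ = ‖((ev f u : Mv) : PadicAlgCl p)‖ := rfl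
    rw [hn, hev]
    refine (Frame.norm_taylorCoeff_le (p := p) hρ0 hΦ zero_le_one (fun s => ?_) _).trans ?_
    · rw [coeff_monomial]
      split_ifs <;> simp
    · rw [one_mul, hpρ]
      exact pow_le_one₀ (by positivity) (inv_le_one_of_one_le₀ hp1.le)
  -- the box principle, after enumerating the two boxes
  have hcardU : Fintype.card BoxU = (E₀ + 1) ^ d₀ * (E₁ + 1) ^ d₁ := by
    simp [BoxU, Fintype.card_prod]
  have hcardN : Fintype.card BoxN = (L + T) ^ n := by simp [BoxN]
  let eU : BoxU ≃ Fin (Fintype.card BoxU) := Fintype.equivFin BoxU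
  let eN : BoxN ≃ Fin (Fintype.card BoxN) := Fintype.equivFin BoxN
  obtain ⟨q', hq'0, hq'Q, hq'small⟩ := ha (Fintype.card BoxU) (Fintype.card BoxN) Q L
    (fun r s => ev (eN.symm r) (eU.symm s)) (fun r s => hev1 _ _) (by
      rw [hcardU, hcardN]
      rw [hE₀, hE₁] at *
      exact hP1)
  -- back to the boxes
  let q : BoxU → ℤ := fun u => q' (eU u)
  have hq0 : q ≠ 0 := by
    intro h0
    apply hq'0
    funext s
    have := congrFun h0 (eU.symm s)
    simpa [q] using this
  have hqQ : ∀ u, |q u| ≤ Q := fun u => hq'Q (eU u)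
  have hqsmall : ∀ f : BoxN, ‖∑ u, (q u : ℚ_[p]) • ev f u‖ ≤ (p : ℝ) ^ (-(L : ℤ)) := by
    intro f
    have := hq'small (eN f)
    rw [Equiv.symm_apply_apply] at this
    refine le_of_eq_of_le ?_ this
    rw [← Equiv.sum_comp eU]
    simp [q]
  -- the polynomial
  set P : MvPolynomial (Fin d₀ ⊕ Fin d₁) (PadicAlgCl p) := boxPoly (PadicAlgCl p) E₀ E₁ q with hPdef
  have hPne : P ≠ 0 := boxPoly_ne_zero E₀ E₁ hq0
  have hPX : degX P ≤ D₀ := (degX_boxPoly_le E₀ E₁ q).trans hE₀D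
  have hPY : degY P ≤ D₁ := (degY_boxPoly_le E₀ E₁ q).trans hE₁D
  have hPcoeff : ∀ s, ‖coeff s P‖ ≤ 1 := by
    intro s
    rcases coeff_boxPoly_cases (F := PadicAlgCl p) E₀ E₁ q s with h0 | ⟨u, -, hu⟩
    · rw [hPdef, h0, norm_zero]; exact zero_le_one
    · rw [hPdef, hu]; exact PadicExp.norm_intCast_le_one (ℓ := p) _
  -- its low Taylor coefficients are small
  have htcP : ∀ κ : Fin n →₀ ℕ, κ.degree < L + T → ‖Φ.taylorCoeff κ P‖ ≤ (p : ℝ) ^ (-(L : ℤ)) := by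
    intro κ hκ
    have hκv : ∀ v, κ v < L + T := fun v => lt_of_le_of_lt (Finsupp.le_degree v κ) hκ
    let f : BoxN := fun v => ⟨κ v, hκv v⟩
    have hf : κof f = κ := by ext v; rfl
    have h1 : (Φ.taylorCoeff κ P : PadicAlgCl p) = ((∑ u, (q u : ℚ_[p]) • ev f u : Mv) : PadicAlgCl p) := by
      rw [hPdef, taylorCoeff_boxPoly, Submodule.coe_sum]
      refine Finset.sum_congr rfl fun u _ => ?_
      rw [Submodule.coe_smul, hev, hf, Algebra.smul_def, map_intCast]
    rw [h1]
    exact hqsmall f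
  refine ⟨P, hPne, hPX, hPY, fun h hh => ?_⟩
  -- a word with letters in `span (range w)`: reduce to letters `w_{τ(l)}`
  rw [vanishesAlg_span_iff]
  intro ℓ hℓ u hu
  choose τ hτ using hu
  have huτ : u = fun l => Φ.vec (wt (τ l)) := funext fun l => (hτ l).symm
  rw [huτ]
  set R := wordDeriv (fun l => Φ.vec (wt (τ l))) P with hRdef
  set g := gammaOf (fun i => Φ.vec (yt i)) α (Multiplicative.ofAdd fun i => (h i : ℤ)) with hgdef
  -- (1) `‖R(γ(h))‖ ≤ p^{-L}`
  have hsmall : ‖evalAt R g‖ ≤ (p : ℝ) ^ (-(L : ℤ)) := by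
    have htcR : ∀ κ : Fin n →₀ ℕ, κ.degree < L → ‖Φ.taylorCoeff κ R‖ ≤ (p : ℝ) ^ (-(L : ℤ)) := by
      intro κ hκ
      rw [hRdef]
      exact Frame.norm_taylorCoeff_wordDeriv_le (p := p) (cs := fun l => wt (τ l)) (fun l k => hwt _ k)
        (by positivity) κ fun κ' _ h2 => htcP κ' (by omega)
    have hcoR : ∀ s, ‖coeff s R‖ ≤ 1 := fun s => by
      rw [hRdef]
      exact Frame.norm_coeff_wordDeriv_le (p := p) hρ0 hρ1 hΦ (cs := fun l => wt (τ l)) (fun l k => hwt _ k)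
        zero_le_one hPcoeff s
    have h1 := Frame.norm_expPolyVal_le ι hι hρ0 hρp hΦ zero_le_one (by positivity) hcoR htcR
      (u := fun k => ∑ i, (h i : PadicAlgCl p) * yt i k) (Frame.norm_natSum_le (p := p) hyt h)
    have hpL : (1 : ℝ) * ((p : ℝ) * ρ) ^ L = (p : ℝ) ^ (-(L : ℤ)) := by
      rw [one_mul, hpρ, zpow_neg, zpow_natCast, inv_pow]
    rw [hpL, max_self] at h1
    have h2 := Frame.coe_evalAt_gammaOf_eq_expPolyVal ι hι hρ0 hρp hΦ hyt (α := α) hα R h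
    rw [← hι, hgdef, h2]
    exact h1
  -- (2) the same number in `k₀`
  let P₀ : MvPolynomial (Fin d₀ ⊕ Fin d₁) k₀ := boxPoly k₀ E₀ E₁ q
  let R₀ := wordDeriv (fun l => w₀ (τ l)) P₀
  let γ₀ := gammaOf (fun i => (y₀ i, (0 : Fin d₁ → k₀))) α₀ (Multiplicative.ofAdd fun i => (h i : ℤ))
  have hmapP : map e P₀ = P := by rw [hPdef]; exact map_boxPoly e E₀ E₁ q
  have hmapR : map e R₀ = R := by
    rw [hRdef, ← hmapP]
    change map e (wordDeriv (fun l => w₀ (τ l)) P₀) = _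
    rw [mapHom_wordDeriv]
    congr 1
    funext l
    exact hw₀ (τ l)
  have hmapγ : ptMapHom e γ₀ = g := by
    change ptMapHom e (gammaOf (fun i => (y₀ i, (0 : Fin d₁ → k₀))) α₀ (Multiplicative.ofAdd fun i => (h i : ℤ))) = _
    rw [ptMapHom_gammaOf, hgdef]
    have hαe : (fun i j => Units.map (e : k₀ →* PadicAlgCl p) (α₀ i j)) = α := by
      funext i j
      ext
      exact hα₀ i j
    rw [hαe, gammaOf_congr_fst (y' := fun i => Φ.vec (yt i))]
    intro i
    funext i₀
    exact hy₀ i i₀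
  have heval : evalAt R g = e (evalAt R₀ γ₀) := by rw [← evalAt_mapHom, hmapR, hmapγ]
  -- sizes in `k₀`
  have hCg0 : 0 ≤ Cg := zero_le_one.trans hCg
  have hP₀c : ∀ s, IsGood d 0 (Q : ℝ) (coeff s P₀) := by
    intro s
    rcases coeff_boxPoly_cases (F := k₀) E₀ E₁ q s with h0 | ⟨u', -, hu'⟩
    · change IsGood d 0 (Q : ℝ) (coeff s (boxPoly k₀ E₀ E₁ q))
      rw [h0]
      exact IsGood.zero (by positivity)
    · change IsGood d 0 (Q : ℝ) (coeff s (boxPoly k₀ E₀ E₁ q))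
      rw [hu']
      refine (IsGood.intCast (q u')).mono ?_
      rw [← Int.cast_abs]
      exact_mod_cast hqQ u'
  have hP₀X : degX P₀ ≤ D₀ := (degX_boxPoly_le E₀ E₁ q).trans hE₀D
  have hP₀Y : degY P₀ ≤ D₁ := (degY_boxPoly_le E₀ E₁ q).trans hE₁D
  have hR₀c := isGood_coeff_wordDeriv (d := d) (C := Cg) hCg0 (u := fun l => w₀ (τ l))
    (fun l i => (hgw (τ l)).1 i) (fun l j => (hgw (τ l)).2 j) (by positivity : (0 : ℝ) ≤ Q) hP₀X hP₀Y hP₀c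
  have hR₀X : degX R₀ ≤ D₀ := (degX_wordDeriv_le _ _).trans hP₀X
  have hR₀Y : degY R₀ ≤ D₁ := (degY_wordDeriv_le _ _).trans hP₀Y
  have hξ := isGood_evalAt_gammaOf (y := fun i => (y₀ i, (0 : Fin d₁ → k₀))) (α := α₀) hCg hd
    (fun i i₀ => hgy i i₀) hgα hh (by positivity) hR₀X hR₀Y hR₀c
  rw [zero_add] at hξ
  -- the bound is `≥ 1`
  set Btot : ℝ := ((((max D₀ D₁ + 1) ^ (d₀ + d₁) : ℕ) : ℝ) * ((Q : ℝ) * (Cg * ((d₀ : ℝ) * (D₀ + 1) + D₁ + 1)) ^ ℓ *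
      (((|(d : ℝ)|) * ((m : ℝ) * S * Cg + 1)) ^ D₀ * ((|(d : ℝ)|) ^ 2 * Cg) ^ (m * S * D₁)))) with hBtot
  have hd1 : (1 : ℝ) ≤ |(d : ℝ)| := by
    rw [← Int.cast_abs]; exact_mod_cast Int.one_le_abs hd
  have hB1 : 1 ≤ Btot := by
    rw [hBtot]
    refine one_le_mul_of_one_le_of_one_le (by exact_mod_cast Nat.one_le_pow _ _ (Nat.succ_pos _)) ?_
    refine one_le_mul_of_one_le_of_one_le (one_le_mul_of_one_le_of_one_le (by exact_mod_cast hQ1)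
      (one_le_pow₀ (one_le_mul_of_one_le_of_one_le hCg ?_))) ?_
    · have : (0 : ℝ) ≤ (d₀ : ℝ) * (D₀ + 1) + D₁ := by positivity
      linarith
    · refine one_le_mul_of_one_le_of_one_le (one_le_pow₀ (one_le_mul_of_one_le_of_one_le hd1 ?_))
        (one_le_pow₀ (one_le_mul_of_one_le_of_one_le (one_le_pow₀ hd1) hCg))
      have : (0 : ℝ) ≤ (m : ℝ) * S * Cg := by positivity
      linarith
  -- (3) Liouville
  by_contra hne
  have hne₀ : evalAt R₀ γ₀ ≠ 0 := by
    intro h0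
    apply hne
    rw [heval, h0, map_zero]
  have hL := norm_map_ge_of_isGood p (ι.comp e) hne₀ hd hB1 hξ
  rw [RingHom.comp_apply, hι, ← heval] at hL
  have h3 := hP2 ℓ hℓ
  have h4 : (p : ℝ) ^ (-(L : ℤ)) < (Btot ^ finrank ℚ k₀)⁻¹ := by
    rw [zpow_neg, zpow_natCast]
    exact (inv_lt_inv₀ (by positivity) (by positivity)).2 h3
  exact absurd (hL.trans hsmall) (not_le.2 h4)

end Core

end LinGroupK

end Literature.NumberTheory.Transcendental
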